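import Summits.HubbardSuperconductivity.HubbardLadder.Su2WeightZeroReduction

/-!
# PieceDecomposition — a variational bound assembled from orthogonal pieces

HONEST FRAMING: ladder R1–R4 with certified numbers; no claim on H/H₀; first certified bounds; not a
superconductivity verdict.  Pure finite-dimensional linear algebra; cell pub-hubbard, lane r2 (g43); part (b) of the
cluster-row assembly [C] agreed with lane r2-eng-1 (g12): companion of the tree's `Su2WeightZeroReduction` ([D]),
`ClusterCutRowTorus` ([A]+[R]) and `PsdCert` / `PsdCertFactor` (the kernel block certificates).

WHAT: let `P t` (`t ∈ T`, finite) be Hermitian matrices with `P t * P t' = 0` for `t ≠ t'`, each commuting with a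
matrix `X`, and resolving every vector of a set `K = {v | Z *ᵥ v = 0}` (`∑ t, P t *ᵥ v = v`).  Then on `K` the
quadratic form of `X` and the norm split over the pieces with NO cross terms
(`quadForm_eq_sum_pieces`, `normSq_eq_sum_pieces`), so per-piece variational bounds
`s‖P t v‖² ≤ Re⟨P t v, X P t v⟩` add up to `s‖v‖² ≤ Re⟨v, X v⟩` on `K` (`rayleigh_ge_of_pieces`) — whose conclusion is
verbatim the weight-zero hypothesis `h0` of `ClusterCut.posSemidef_sub_smul_of_weightZero_spinHalf` (`Z = totalSpin 1 2`).
§2 supplies the per-piece bounds from FRAMES: if `Φᴴ (k•X) Φ − σ•ΦᴴΦ ⪰ 0` (the shape `B_b − s·G_b ⪰ 0` of a kernel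
block certificate, `k` the integer scaling) then `σ/k · ‖Φc‖² ≤ Re⟨Φc, X Φc⟩` (`rayleigh_ge_of_frame`), a piece whose range
in `K` is spanned by `Φ` inherits it (`piece_bound_of_frame`), and a real / integer PSD certificate transfers to `ℂ`
(`posSemidef_map_ofRealHom`, `posSemidef_map_intCast_complex`).
In the cluster-row application the pieces are the joint eigenspaces of the commuting lattice-symmetry and spin-flip
involutions of the cluster operator, and each per-piece bound is a kernel-checked integer PSD certificate.
References: Horn–Johnson (2013) Thm 1.3.12, 4.1.5 (commuting normal families, compressions); all statements [folklore].
-/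

namespace Summit.HubbardSuperconductivity.HubbardLadder.ClusterCut

open Matrix Complex Finset
open scoped ComplexOrder

variable {ι T : Type*} [Fintype ι] [Fintype T]

/-- On a vector resolved by pairwise-orthogonal pieces, each piece acts idempotently. [folklore] -/
theorem piece_idem_apply (P : T → Matrix ι ι ℂ) (horth : ∀ t t', t ≠ t' → P t * P t' = 0)
    {v : ι → ℂ} (hres : ∑ t, P t *ᵥ v = v) (t : T) : (P t * P t) *ᵥ v = P t *ᵥ v := by
  have h : P t *ᵥ (∑ t', P t' *ᵥ v) = ∑ t', (P t * P t') *ᵥ v := by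
    rw [Matrix.mulVec_sum]
    exact Finset.sum_congr rfl fun t' _ => Matrix.mulVec_mulVec _ _ _
  rw [hres] at h
  rw [h, Finset.sum_eq_single t]
  · intro t' _ ht'
    rw [horth t t' (Ne.symm ht'), Matrix.zero_mulVec]
  · intro ht
    exact absurd (Finset.mem_univ t) ht

/-- Diagonal term of the quadratic form: `⟨P t v, X (P t v)⟩ = ⟨v, X (P t v)⟩` for a Hermitian piece commuting with `X`
(orthogonal resolution). [folklore] -/
theorem piece_quadForm_diag {X : Matrix ι ι ℂ} (P : T → Matrix ι ι ℂ) (hherm : ∀ t, (P t)ᴴ = P t)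
    (horth : ∀ t t', t ≠ t' → P t * P t' = 0) (hcomm : ∀ t, X * P t = P t * X)
    {v : ι → ℂ} (hres : ∑ t, P t *ᵥ v = v) (t : T) :
    star (P t *ᵥ v) ⬝ᵥ X *ᵥ (P t *ᵥ v) = star v ⬝ᵥ X *ᵥ (P t *ᵥ v) := by
  have hid := piece_idem_apply P horth hres t
  calc star (P t *ᵥ v) ⬝ᵥ X *ᵥ (P t *ᵥ v)
      = (star v ᵥ* P t) ⬝ᵥ X *ᵥ (P t *ᵥ v) := by rw [Matrix.star_mulVec, hherm]
    _ = star v ⬝ᵥ P t *ᵥ X *ᵥ (P t *ᵥ v) := by rw [← Matrix.dotProduct_mulVec]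
    _ = star v ⬝ᵥ (P t * (X * P t)) *ᵥ v := by simp only [Matrix.mulVec_mulVec]
    _ = star v ⬝ᵥ (X * (P t * P t)) *ᵥ v := by rw [← Matrix.mul_assoc, ← hcomm t, Matrix.mul_assoc]
    _ = star v ⬝ᵥ X *ᵥ (P t *ᵥ v) := by rw [← hid]; simp only [Matrix.mulVec_mulVec]

/-- **No cross terms**: on a resolved vector the quadratic form of `X` is the sum of the per-piece forms. [folklore] -/
theorem quadForm_eq_sum_pieces {X : Matrix ι ι ℂ} (P : T → Matrix ι ι ℂ) (hherm : ∀ t, (P t)ᴴ = P t)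
    (horth : ∀ t t', t ≠ t' → P t * P t' = 0) (hcomm : ∀ t, X * P t = P t * X)
    {v : ι → ℂ} (hres : ∑ t, P t *ᵥ v = v) :
    star v ⬝ᵥ X *ᵥ v = ∑ t, star (P t *ᵥ v) ⬝ᵥ X *ᵥ (P t *ᵥ v) := by
  have h1 : X *ᵥ v = ∑ t, X *ᵥ (P t *ᵥ v) := by
    rw [← Matrix.mulVec_sum, hres]
  rw [h1, dotProduct_sum]
  exact Finset.sum_congr rfl fun t _ => (piece_quadForm_diag P hherm horth hcomm hres t).symm

/-- **Pythagoras over the pieces**: `‖v‖² = ∑ ‖P t v‖²` on a resolved vector. [folklore] -/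
theorem normSq_eq_sum_pieces (P : T → Matrix ι ι ℂ) (hherm : ∀ t, (P t)ᴴ = P t)
    (horth : ∀ t t', t ≠ t' → P t * P t' = 0) {v : ι → ℂ} (hres : ∑ t, P t *ᵥ v = v) :
    star v ⬝ᵥ v = ∑ t, star (P t *ᵥ v) ⬝ᵥ (P t *ᵥ v) := by
  have key : ∀ t, star (P t *ᵥ v) ⬝ᵥ (P t *ᵥ v) = star v ⬝ᵥ (P t *ᵥ v) := by
    intro t
    have hid := piece_idem_apply P horth hres t
    calc star (P t *ᵥ v) ⬝ᵥ (P t *ᵥ v)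
        = (star v ᵥ* P t) ⬝ᵥ (P t *ᵥ v) := by rw [Matrix.star_mulVec, hherm]
      _ = star v ⬝ᵥ P t *ᵥ (P t *ᵥ v) := by rw [← Matrix.dotProduct_mulVec]
      _ = star v ⬝ᵥ (P t *ᵥ v) := by rw [Matrix.mulVec_mulVec, hid]
  calc star v ⬝ᵥ v = star v ⬝ᵥ ∑ t, P t *ᵥ v := by rw [hres]
    _ = ∑ t, star v ⬝ᵥ (P t *ᵥ v) := dotProduct_sum _ _ _
    _ = ∑ t, star (P t *ᵥ v) ⬝ᵥ (P t *ᵥ v) := Finset.sum_congr rfl fun t _ => (key t).symm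

/-- **Variational bound from the pieces.**  If the pieces `P t` are Hermitian, pairwise orthogonal, commute with
`X` and resolve every vector of `K = {v | Z *ᵥ v = 0}`, then per-piece bounds `s‖P t v‖² ≤ Re⟨P t v, X P t v⟩`
(`v ∈ K`) give `s‖v‖² ≤ Re⟨v, X v⟩` on `K` — the hypothesis `h0` of
`ClusterCut.posSemidef_sub_smul_of_weightZero_spinHalf`. [folklore] -/
theorem rayleigh_ge_of_pieces {X Z : Matrix ι ι ℂ} (P : T → Matrix ι ι ℂ)
    (hherm : ∀ t, (P t)ᴴ = P t) (horth : ∀ t t', t ≠ t' → P t * P t' = 0)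
    (hcomm : ∀ t, X * P t = P t * X) (hres : ∀ v, Z *ᵥ v = 0 → ∑ t, P t *ᵥ v = v) {s : ℝ}
    (hblk : ∀ t v, Z *ᵥ v = 0 →
      s * (star (P t *ᵥ v) ⬝ᵥ (P t *ᵥ v)).re ≤ (star (P t *ᵥ v) ⬝ᵥ X *ᵥ (P t *ᵥ v)).re)
    (v : ι → ℂ) (hv : Z *ᵥ v = 0) : s * (star v ⬝ᵥ v).re ≤ (star v ⬝ᵥ X *ᵥ v).re := by
  rw [quadForm_eq_sum_pieces P hherm horth hcomm (hres v hv), normSq_eq_sum_pieces P hherm horth (hres v hv),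
    Complex.re_sum, Complex.re_sum, Finset.mul_sum]
  exact Finset.sum_le_sum fun t _ => hblk t v hv

/-- The same bound with the per-piece hypotheses stated on the RANGE of each piece inside `K`
(`u = P t v`, `v ∈ K`), the form in which frame certificates are produced. [folklore] -/
theorem rayleigh_ge_of_pieces' {X Z : Matrix ι ι ℂ} (P : T → Matrix ι ι ℂ)
    (hherm : ∀ t, (P t)ᴴ = P t) (horth : ∀ t t', t ≠ t' → P t * P t' = 0)
    (hcomm : ∀ t, X * P t = P t * X) (hres : ∀ v, Z *ᵥ v = 0 → ∑ t, P t *ᵥ v = v) {s : ℝ}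
    (hblk : ∀ t u, (∃ v, Z *ᵥ v = 0 ∧ u = P t *ᵥ v) → s * (star u ⬝ᵥ u).re ≤ (star u ⬝ᵥ X *ᵥ u).re) :
    ∀ v, Z *ᵥ v = 0 → s * (star v ⬝ᵥ v).re ≤ (star v ⬝ᵥ X *ᵥ v).re :=
  fun v hv => rayleigh_ge_of_pieces P hherm horth hcomm hres (fun t w hw => hblk t _ ⟨w, hw, rfl⟩) v hv

/-! ## §2 Frames: a per-piece bound from a PSD certificate of the compressed matrix -/

section Frames

variable {m : Type*} [Fintype m]

/-- Quadratic form on the range of a frame `Φ`: `⟨Φc, A Φc⟩ = ⟨c, (Φᴴ A Φ) c⟩`. [folklore] -/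
theorem frame_quadForm (Φ : Matrix ι m ℂ) (A : Matrix ι ι ℂ) (c : m → ℂ) :
    star (Φ *ᵥ c) ⬝ᵥ A *ᵥ (Φ *ᵥ c) = star c ⬝ᵥ (Φᴴ * A * Φ) *ᵥ c := by
  rw [Matrix.star_mulVec, ← Matrix.dotProduct_mulVec]
  simp only [Matrix.mulVec_mulVec, Matrix.mul_assoc]

/-- Norm on the range of a frame: `‖Φc‖² = ⟨c, (Φᴴ Φ) c⟩` (the Gram matrix). [folklore] -/
theorem frame_normSq (Φ : Matrix ι m ℂ) (c : m → ℂ) :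
    star (Φ *ᵥ c) ⬝ᵥ (Φ *ᵥ c) = star c ⬝ᵥ (Φᴴ * Φ) *ᵥ c := by
  rw [Matrix.star_mulVec, ← Matrix.dotProduct_mulVec, Matrix.mulVec_mulVec]

/-- **Frame certificate ⇒ variational bound on the range.**  If the compressed matrix
`Φᴴ (k•X) Φ − σ • ΦᴴΦ` is positive semidefinite (`k > 0` the integer scaling of the cluster operator, `σ` the
scaled threshold — the shape `B_b − s·G_b ⪰ 0` of the kernel block certificates), then `σ/k · ‖u‖² ≤ Re⟨u, X u⟩` for
every `u = Φ c`. [folklore] -/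
theorem rayleigh_ge_of_frame {X : Matrix ι ι ℂ} (Φ : Matrix ι m ℂ) {k σ : ℝ} (hk : 0 < k)
    (hpsd : (Φᴴ * ((k : ℂ) • X) * Φ - (σ : ℂ) • (Φᴴ * Φ)).PosSemidef) (c : m → ℂ) :
    σ / k * (star (Φ *ᵥ c) ⬝ᵥ (Φ *ᵥ c)).re ≤ (star (Φ *ᵥ c) ⬝ᵥ X *ᵥ (Φ *ᵥ c)).re := by
  have h0 := hpsd.dotProduct_mulVec_nonneg c
  rw [Matrix.mul_smul, Matrix.smul_mul, Matrix.sub_mulVec, Matrix.smul_mulVec,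
    Matrix.smul_mulVec, dotProduct_sub, dotProduct_smul, dotProduct_smul, ← frame_quadForm Φ X c,
    ← frame_normSq Φ c, Complex.nonneg_iff] at h0
  have h1 := h0.1
  simp only [Complex.sub_re, smul_eq_mul, Complex.mul_re, Complex.ofReal_re, Complex.ofReal_im, zero_mul,
    sub_zero] at h1
  rw [div_mul_eq_mul_div, div_le_iff₀ hk]
  linarith

/-- A piece whose range inside `K = {v | Z *ᵥ v = 0}` is spanned by a frame inherits the frame's bound — the
per-piece hypothesis `hblk` of `rayleigh_ge_of_pieces`. [folklore] -/
theorem piece_bound_of_frame {X Z : Matrix ι ι ℂ} (Pt : Matrix ι ι ℂ) (Φ : Matrix ι m ℂ) {s : ℝ}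
    (hspan : ∀ v, Z *ᵥ v = 0 → ∃ c : m → ℂ, Pt *ᵥ v = Φ *ᵥ c)
    (hframe : ∀ c : m → ℂ,
      s * (star (Φ *ᵥ c) ⬝ᵥ (Φ *ᵥ c)).re ≤ (star (Φ *ᵥ c) ⬝ᵥ X *ᵥ (Φ *ᵥ c)).re)
    (v : ι → ℂ) (hv : Z *ᵥ v = 0) :
    s * (star (Pt *ᵥ v) ⬝ᵥ (Pt *ᵥ v)).re ≤ (star (Pt *ᵥ v) ⬝ᵥ X *ᵥ (Pt *ᵥ v)).re := by
  obtain ⟨c, hc⟩ := hspan v hv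
  rw [hc]
  exact hframe c

/-- A real positive semidefinite matrix stays positive semidefinite over `ℂ` (the bridge from a real / integer
kernel certificate to the complex setting above). [folklore] -/
theorem posSemidef_map_ofRealHom {Q : Matrix m m ℝ} [DecidableEq m] (hQ : Q.PosSemidef) :
    (Q.map Complex.ofRealHom).PosSemidef := by
  open scoped MatrixOrder in
  obtain ⟨B, hB⟩ := CStarAlgebra.nonneg_iff_eq_star_mul_self.mp hQ.nonneg
  rw [hB, Matrix.star_eq_conjTranspose, Matrix.map_mul,
    Matrix.conjTranspose_map _ (fun a => by simp)]
  exact Matrix.posSemidef_conjTranspose_mul_self _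

/-- Integer data: `Q.map (ℤ → ℝ) ⪰ 0` implies `Q.map (ℤ → ℂ) ⪰ 0`. [folklore] -/
theorem posSemidef_map_intCast_complex {Q : Matrix m m ℤ} [DecidableEq m]
    (hQ : (Q.map (Int.cast : ℤ → ℝ)).PosSemidef) : (Q.map (Int.cast : ℤ → ℂ)).PosSemidef := by
  have h := posSemidef_map_ofRealHom hQ
  rw [Matrix.map_map] at h
  convert h using 2
  funext a
  simp

end Frames

end Summit.HubbardSuperconductivity.HubbardLadder.ClusterCut
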